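import Summits.KontsevichZagierPeriods.KontsevichZagierPeriods.Theses.CompiledSubstitutions
import Summits.KontsevichZagierPeriods.KontsevichZagierPeriods.Theorems.BetaCancellation.Negative.LoadBearing
import Literature.NumberTheory.Transcendental.KZProductIdeal
import Literature.NumberTheory.Transcendental.KZMellinFibres
import Literature.NumberTheory.Transcendental.KZRelationsLE
import Literature.NumberTheory.Transcendental.KZLogCalculusProofs
import Literature.NumberTheory.Transcendental.KZDominatedFamilyRelations
import Literature.NumberTheory.Transcendental.KZSemialgebraicComplex
import Literature.NumberTheory.Transcendental.GammaMonomialsProofs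

/-!
# Euler reflection inside the calculus (item stmt-KontsevichZagierPeriods-3383) — skeleton of the lead's stub

`EulerReflectionRational`: for rational `a = p/q ∈ (0,1)`,
`[(0,1), sin(πa) x^{a-1}(1-x)^{-a}] ∼ [disc, 1]` by the moves. One-dimensional plan:

1. `stub_eulerRationalise`: on `(0,1/2)` the substitution `x = s^q/(1+s^q)` turns the kernel
   into the rational integrand `q s^{p-1}/(1+s^q)` on `(0,1)` (one rule-2 move); the upper half
   `[1/2,1)` is first reflected (`x ↦ 1−x`, `a ↦ 1−a`).
2. `stub_eulerPartialFractions`: the real partial-fraction identity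
   `q(s^{p-1}+s^{q-p-1})/(1+s^q) = Σ_{j<q/2} 4 sin(pθ_j) sin θ_j/(s²−2s cos θ_j+1)`,
   `θ_j = (2j+1)π/q`.
3. affine substitutions `m = (s − cos θ_j)/sin θ_j` (lead) put every term on an interval of the
   `m`-line with the integrand `c_j/(1+m²)`;
4. `stub_moebiusMove`: the Möbius rotations `t ↦ (ct − s)/(st + c)` (`c²+s²=1` algebraic)
   preserve `dt/(1+t²)` (one rule-2 move each) and carry every piece of arctan-length `π/(2q)` onto
   the fundamental interval `(0, tan(π/(2q)))`;
5. `stub_piAsArctan`: `[(-1,1), 2/(1+t²)] ∼ [disc, 1]` (KZ §1.1: `x = 2t/(1+t²)` onto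
   `1/√(1−x²)`, then Kontsevich–Zagier's `2√(1−x²)` step and the disc);
6. the trigonometric bookkeeping `Σ_j (q−2j−1)·4 sin(πp/q) sin(pθ_j) = 2q` and the assembly by
   domain/integrand additivity (lead, `stub_eulerGlue` until proved).
-/

noncomputable section

-- `Summit.KontsevichZagierPeriods.KontsevichZagierPeriods.…` is the tree's mandated layout (single-conjunct summit).
set_option linter.dupNamespace false

namespace Summit.KontsevichZagierPeriods.KontsevichZagierPeriods.BetaCancellationLine

open MeasureTheory Set
open Literature.NumberTheory.Transcendental
open Literature.NumberTheory.Transcendental.KZ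
open Literature.ModelTheory.ExponentialFields (IsSemialgebraic isSemialgebraic_univ)
open MvPolynomial (aeval X C)
open Summit.KontsevichZagierPeriods.KontsevichZagierPeriods.Theses.CompiledSubstitutions
  (EulerReflectionRational)
open Summit.KontsevichZagierPeriods.KontsevichZagierPeriods.BetaCancellationNegative

/-! ## Registered Euler stubs -/

/-- STUB: rationalising substitution `x = s^q/(1+s^q)` on the lower half:
`[(0,1/2), x^{p/q-1}(1-x)^{-p/q}] ∼ [(0,1), q s^{p-1}/(1+s^q)]` (one rule-2 move). [folklore] -/
theorem stub_eulerRationalise : ∀ (p q : ℕ), 0 < p → p < q →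
    ∀ (H G : Literature.NumberTheory.Transcendental.KZ.IntegralRep 1),
    H.domain = {x | x 0 ∈ Set.Ioo (0:ℝ) (1/2)} →
    Set.EqOn H.integrand (fun x => (x 0) ^ ((p:ℝ) / q - 1) * (1 - x 0) ^ (-((p:ℝ) / q))) H.domain →
    G.domain = {x | x 0 ∈ Set.Ioo (0:ℝ) 1} →
    Set.EqOn G.integrand (fun x => (q:ℝ) * (x 0) ^ (p - 1) / (1 + (x 0) ^ q)) G.domain →
    Literature.NumberTheory.Transcendental.KZ.Equivalent H G := by
  sorry

/-- STUB: the real partial-fraction expansion of `q(s^{p-1}+s^{q-p-1})/(1+s^q)` over the pairs of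
complex-conjugate roots of `s^q + 1` (`θ_j = (2j+1)π/q`, `j < q/2`; the real root `−1`, present
for odd `q`, has residue `0`). [folklore] -/
theorem stub_eulerPartialFractions : ∀ (p q : ℕ), 0 < p → p < q → ∀ s : ℝ,
    (q:ℝ) * (s ^ (p - 1) + s ^ (q - p - 1)) =
      (1 + s ^ q) * ∑ j ∈ Finset.range (q / 2),
        4 * Real.sin (Real.pi * (2 * j + 1) * p / q) * Real.sin (Real.pi * (2 * j + 1) / q) /
          (s ^ 2 - 2 * Real.cos (Real.pi * (2 * j + 1) / q) * s + 1) := by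
  sorry

/-- STUB: the Möbius rotation `t ↦ (ct − s)/(st + c)` (`c² + s² = 1`, `c, s` algebraic) is ONE
rule-2 move preserving the integrand `κ/(1+t²)` on any interval where `st + c > 0`. [folklore] -/
theorem stub_moebiusMove : ∀ (c s κ : ℝ), IsAlgebraic ℚ c → IsAlgebraic ℚ s → IsAlgebraic ℚ κ →
    c ^ 2 + s ^ 2 = 1 → ∀ (u v : ℝ), u < v → (∀ t ∈ Set.Icc u v, 0 < s * t + c) →
    ∀ (T T' : Literature.NumberTheory.Transcendental.KZ.IntegralRep 1),
    T.domain = {x | x 0 ∈ Set.Ioo u v} →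
    Set.EqOn T.integrand (fun x => κ / (1 + (x 0) ^ 2)) T.domain →
    T'.domain = {x | x 0 ∈ Set.Ioo ((c * u - s) / (s * u + c)) ((c * v - s) / (s * v + c))} →
    Set.EqOn T'.integrand (fun x => κ / (1 + (x 0) ^ 2)) T'.domain →
    Literature.NumberTheory.Transcendental.KZ.Equivalent T T' := by
  sorry

/-- STUB: `[(-1,1), 2/(1+t²)] ∼ [disc, 1]` (rule 2 with `x = 2t/(1+t²)` onto `[(-1,1), 1/√(1−x²)]`,
then Kontsevich–Zagier's §1.1 chain to the disc). [cite: KontsevichZagier2001, §1.1] -/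
theorem stub_piAsArctan :
    ∀ (T : Literature.NumberTheory.Transcendental.KZ.IntegralRep 1)
      (P : Literature.NumberTheory.Transcendental.KZ.IntegralRep 2),
    T.domain = {x | x 0 ∈ Set.Ioo (-1:ℝ) 1} →
    Set.EqOn T.integrand (fun x => 2 / (1 + (x 0) ^ 2)) T.domain →
    P.domain = {z | z 0 ^ 2 + z 1 ^ 2 ≤ 1} → Set.EqOn P.integrand (fun _ => 1) P.domain →
    Literature.NumberTheory.Transcendental.KZ.Equivalent T P := by
  sorry

/-- STUB: the trigonometric bookkeeping of the assembly,
`Σ_{j<q/2} (q−2j−1)·4 sin(πp/q) sin(p(2j+1)π/q) = 2q`. [folklore] -/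
theorem stub_eulerTrigSum : ∀ (p q : ℕ), 0 < p → p < q → ∑ j ∈ Finset.range (q / 2), ((q:ℝ) - 2 * j - 1) * (4 * Real.sin (Real.pi * p / q) * Real.sin (Real.pi * (2 * j + 1) * p / q)) = 2 * q := by
  sorry

/-- STUB: the affine substitution `x = s·m + c` (`s = sin θ > 0`, `c = cos θ` algebraic) is ONE
rule-2 move: `[(0,1), κ s/(x²−2cx+1)] ∼ [((0−c)/s, (1−c)/s), κ/(1+m²)]`. [folklore] -/
theorem stub_affineMove : ∀ (c s κ : ℝ), IsAlgebraic ℚ c → IsAlgebraic ℚ s → IsAlgebraic ℚ κ → 0 < s → c ^ 2 + s ^ 2 = 1 → ∀ (T A : Literature.NumberTheory.Transcendental.KZ.IntegralRep 1), T.domain = {x | x 0 ∈ Set.Ioo (0:ℝ) 1} → Set.EqOn T.integrand (fun x => κ * s / ((x 0) ^ 2 - 2 * c * (x 0) + 1)) T.domain → A.domain = {x | x 0 ∈ Set.Ioo ((0 - c) / s) ((1 - c) / s)} → Set.EqOn A.integrand (fun x => κ / (1 + (x 0) ^ 2)) A.domain → Literature.NumberTheory.Transcendental.KZ.Equivalent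 T A := by
  sorry

end Summit.KontsevichZagierPeriods.KontsevichZagierPeriods.BetaCancellationLine
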